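import Summits.HodgeConjecture.HodgeConjecture.Theorems.Ring2AbelianAllStandardBUniformCorrespondences
import HarnessLib

/-!
# Ring 2 · sub-cell AbelianAll (ALL ABELIAN VARIETIES), André axis — ab-andre-1 part XV-c (i):
# WHISKER CLASSES — the correspondence `X ◁ T` on `(X × Y) × (X × Y)` induced by ONE algebraic class `T` on `Y × Y`,
# and the swap of cross products

HONEST FRAMING (page 1, verbatim): **research route, not a corollary; conditional on HC_CM plus one named
minimal statement.** Cell line: research route conditional on HC_CM; not a corollary; Q11.4-sentence-2
already refuted in dim ≥ 3. Nothing in this file concerns an open statement: it is unconditional linear algebra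
of Gysin maps and cup products on the real carriers `H•(−(ℂ); ℂ)` (no standard conjecture, no `HC_CM`). Seat
`pub-hodge-ring2-ab-andre-1`, gen 54. 0 `def`, 0 named fact, 0 `sorry`; standard axioms only. Used by the companion
file `Ring2AbelianAllStandardBProducts` (part XV-c (ii): Kleiman 1968 Cor. 2.5, `B⋆` stable under products).

## Contents

* §1 `corrAction_complexGysin_lift`: for `ι = (q, p) : T → W × X` and `κ ∈ H•(T)`, the class `ι_* κ` acts as the
  correspondence `c ↦ q_*(p^* c ∪ κ)` (projection formula for `ι`, functoriality of Gysin maps).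
* §2 `exists_whiskerLeft_corr`: for an algebraic class `δ` on `Y × Y` (codimension `e`) there is ONE algebraic class
  `Γ = c • ι_* pr₂₃^* δ` on `(X × Y) × (X × Y)`, `ι = (X ◁ pr₁, X ◁ pr₂) : X × (Y × Y) → (X × Y)²`, `c` the uniform
  base-change unit of part XV-a (`gysin_baseChange_uniform`), acting on cross products by `x ⊠ v ↦ x ⊠ [δ]_* v` in
  every typed bidegree and by `0` in the untyped ones (Literature `complexGysin_cup_map_eq_zero_of_lt`); and
  `map_swap_cupProduct_cross`: `σ^*(x ⊠ v) = (−1)^{ij} v ⊠ x` for the switch `σ : Y × X → X × Y`.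

References: Fulton 1998 §16.1 (correspondences; Ex. 16.1.2 products of correspondences); Fulton 1997 App. B eq. (5)–(8)
(projection formula, base change); Kleiman 1968 §1.3; Hatcher 2002 Thm. 3.11, Thm. 3.15.
-/

noncomputable section

set_option linter.dupNamespace false

namespace Summit.HodgeConjecture.HodgeConjecture.Ring2.AbelianAll

open CategoryTheory AlgebraicGeometry MonoidalCategory CartesianMonoidalCategory
open Literature.AlgebraicGeometry Literature.AlgebraicGeometry.Motives
open Literature.AlgebraicGeometry.HodgeTheory
open Literature.AlgebraicTopology.SingularHomology (singularCohomology cupProduct cupProduct_assoc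
  cupProduct_gradedComm_holds cupProduct_map gysinMap_restrictCompl_eq_zero_of_field)

/-! ## §1 The action of a class pushed forward along `(q, p) : T → W × X` -/

section Lift

variable (μ : OrientationFamily) {t m n : ℕ} {T W X : SchemeOver ℂ}

/-- **`[(q,p)_* κ]_* = q_* (p^*(·) ∪ κ)`**: for `ι = (q, p) : T → W × X` and `κ ∈ Hᵈ(T(ℂ))`, the correspondence
`Γ = ι_* κ ∈ H^{2e}((W × X)(ℂ))` acts as `c ↦ q_*(p^* c ∪ κ)` — the projection formula for `ι` and functoriality of
Gysin maps (`ι ≫ pr₁ = q`, `ι ≫ pr₂ = p`). Fulton's "correspondence of a morphism pair". [cite: Fulton1998, §16.1 (Def. 16.1.1, Prop. 16.1.1)]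
[cite: FultonYoungTableaux1997, App. B eq. (5) (projection formula)] -/
theorem corrAction_complexGysin_lift (hT : IsSmoothProjective t T) (hW : IsSmoothProjective m W)
    (hX : IsSmoothProjective n X) (q : T ⟶ W) (p : T ⟶ X) {d e a b : ℕ}
    (hde : d + 2 * (m + n) = 2 * e + 2 * t) (hab : a + 2 * e = b + 2 * n) (κ : complexBetti T d)
    (c : complexBetti X a) :
    corrAction μ hW hX hab (complexGysin μ hT (hW.tensor_holds hX) (lift q p) hde κ) c =
      complexGysin μ hT hW q (show a + d + 2 * m = b + 2 * t by omega)
        (cupProduct (rfl : a + d = a + d) (complexBetti.map p a c) κ) := by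
  have hμ : μ.HasPoincareDuality := OrientationFamily.hasPoincareDuality μ
  have hWX := hW.tensor_holds hX
  rw [corrAction_apply, ← complexGysin_cup hμ hT hWX (lift q p) (rfl : a + d = a + d)
    (show a + d + 2 * (m + n) = a + 2 * e + 2 * t by omega) hde rfl]
  have hpull : complexBetti.map (lift q p) a (complexBetti.map (snd W X) a c) = complexBetti.map p a c := by
    have h := complexBetti.map_comp (lift q p) (snd W X) a
    rw [lift_snd] at h
    rw [h, CategoryTheory.comp_apply]
  rw [hpull, ← LinearMap.comp_apply (f := complexGysin μ hWX hW (fst W X) _),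
    ← complexGysin_comp hμ hT hWX hW (lift q p) (fst W X)]
  simp only [lift_fst]

end Lift

/-! ## §2 The whisker `X ◁ T` of a correspondence on `Y`, as ONE class on `(X × Y) × (X × Y)` -/

section Whisker

variable (μ : OrientationFamily) {n m : ℕ} {X Y : SchemeOver ℂ}

/-- **The whisker class.** For `δ ∈ Nᵉ H^{2e}((Y × Y)(ℂ); ℂ)` there is ONE algebraic class
`Γ ∈ N^{e+n} H^{2(e+n)}(((X × Y) × (X × Y))(ℂ); ℂ)` — namely `c • ι_* pr₂₃^* δ` with
`ι = (X ◁ pr₁, X ◁ pr₂) : X × (Y × Y) → (X × Y) × (X × Y)` (the graph-like cycle `Δ_X × D`) and `c` the uniform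
base-change unit of part XV-a — whose action on cross products is `x ⊠ v ↦ x ⊠ [δ]_* v` in every TYPED bidegree
(`j + 2e ≥ 2m`) and ZERO in the untyped ones (`j + 2e < 2m`, where `[δ]_* v` would land in negative degree).
[cite: Kleiman1968AlgebraicCycles, §1.3 (products of correspondences) and Cor. 2.5] [cite: Fulton1998, §16.1 (Ex. 16.1.2)]
[cite: FultonYoungTableaux1997, App. B eq. (5)–(8) (projection formula, base change)] -/
theorem exists_whiskerLeft_corr (hX : IsSmoothProjective n X) (hY : IsSmoothProjective m Y) {e : ℕ}
    {δ : complexBetti (Y ⊗ Y) (2 * e)} (hδ : δ ∈ algebraicClasses (Y ⊗ Y) e) :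
    ∃ Γ ∈ algebraicClasses ((X ⊗ Y) ⊗ (X ⊗ Y)) (e + n),
      (∀ {i j k b k₁ : ℕ} (hij : i + j = k) (hjb : j + 2 * e = b + 2 * m)
          (hk : k + 2 * (e + n) = k₁ + 2 * (n + m)) (hib : i + b = k₁) (x : complexBetti X i)
          (v : complexBetti Y j),
        corrAction μ (hX.tensor_holds hY) (hX.tensor_holds hY) hk Γ
            (cupProduct hij (complexBetti.map (fst X Y) i x) (complexBetti.map (snd X Y) j v)) =
          cupProduct hib (complexBetti.map (fst X Y) i x)
            (complexBetti.map (snd X Y) b (corrAction μ hY hY hjb δ v))) ∧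
      (∀ {i j k k₁ : ℕ} (hij : i + j = k) (_ : j + 2 * e < 2 * m)
          (hk : k + 2 * (e + n) = k₁ + 2 * (n + m)) (x : complexBetti X i) (v : complexBetti Y j),
        corrAction μ (hX.tensor_holds hY) (hX.tensor_holds hY) hk Γ
            (cupProduct hij (complexBetti.map (fst X Y) i x) (complexBetti.map (snd X Y) j v)) = 0) := by
  have hμ : μ.HasPoincareDuality := OrientationFamily.hasPoincareDuality μ
  have hP := hX.tensor_holds hY
  have hYY := hY.tensor_holds hY
  have hT := hX.tensor_holds hYY
  have hPP := hP.tensor_holds hP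
  obtain ⟨c, hc⟩ := gysin_baseChange_uniform μ hX hY hY
  -- the class `κ = pr₂₃^* δ` on `X × (Y × Y)` and its push-forward along `ι`
  have hκ : complexBetti.map (snd X (Y ⊗ Y)) (2 * e) δ ∈ algebraicClasses (X ⊗ (Y ⊗ Y)) e :=
    map_snd_mem_supportedClasses hX hYY hδ
  have hde : 2 * e + 2 * ((n + m) + (n + m)) = 2 * (e + n) + 2 * (n + (m + m)) := by omega
  have hΓ₀ : complexGysin μ hT hPP (lift (X ◁ fst Y Y) (X ◁ snd Y Y)) hde
      (complexBetti.map (snd X (Y ⊗ Y)) (2 * e) δ) ∈ algebraicClasses ((X ⊗ Y) ⊗ (X ⊗ Y)) (e + n) :=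
    complexGysin_mem_algebraicClasses (gysinMap_restrictCompl_eq_zero_of_field ℂ) μ hμ hT hPP
      (lift (X ◁ fst Y Y) (X ◁ snd Y Y)) (show e + ((n + m) + (n + m)) = (e + n) + (n + (m + m)) by omega)
      hde hκ
  -- `p^*(pr₁^* x ∪ pr₂^* v) ∪ pr₂₃^* δ = q^* pr₁^* x ∪ pr₂₃^* (pr₂^* v ∪ δ)` on `X × (Y × Y)`
  have key : ∀ {i j k : ℕ} (hij : i + j = k) (x : complexBetti X i) (v : complexBetti Y j),
      cupProduct (rfl : k + 2 * e = k + 2 * e)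
          (complexBetti.map (X ◁ snd Y Y) k
            (cupProduct hij (complexBetti.map (fst X Y) i x) (complexBetti.map (snd X Y) j v)))
          (complexBetti.map (snd X (Y ⊗ Y)) (2 * e) δ) =
        cupProduct (show i + (j + 2 * e) = k + 2 * e by omega)
          (complexBetti.map (X ◁ fst Y Y) i (complexBetti.map (fst X Y) i x))
          (complexBetti.map (snd X (Y ⊗ Y)) (j + 2 * e)
            (cupProduct rfl (complexBetti.map (snd Y Y) j v) δ)) := by
    intro i j k hij x v
    have hx : complexBetti.map (X ◁ snd Y Y) i (complexBetti.map (fst X Y) i x) =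
        complexBetti.map (X ◁ fst Y Y) i (complexBetti.map (fst X Y) i x) := by
      have h1 := complexBetti.map_comp (X ◁ snd Y Y) (fst X Y) i
      have h2 := complexBetti.map_comp (X ◁ fst Y Y) (fst X Y) i
      rw [whiskerLeft_fst] at h1 h2
      rw [← CategoryTheory.comp_apply (f := complexBetti.map (fst X Y) i)
          (g := complexBetti.map (X ◁ snd Y Y) i), ← h1, h2, CategoryTheory.comp_apply]
    have hv : complexBetti.map (X ◁ snd Y Y) j (complexBetti.map (snd X Y) j v) =
        complexBetti.map (snd X (Y ⊗ Y)) j (complexBetti.map (snd Y Y) j v) := by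
      have h1 := complexBetti.map_comp (X ◁ snd Y Y) (snd X Y) j
      have h2 := complexBetti.map_comp (snd X (Y ⊗ Y)) (snd Y Y) j
      rw [whiskerLeft_snd] at h1
      rw [← CategoryTheory.comp_apply (f := complexBetti.map (snd X Y) j)
          (g := complexBetti.map (X ◁ snd Y Y) j), ← h1, h2, CategoryTheory.comp_apply]
    rw [cupProduct_map, hx, hv, cupProduct_assoc hij rfl rfl (show i + (j + 2 * e) = k + 2 * e by omega),
      ← cupProduct_map]
  refine ⟨c • _, Submodule.smul_mem _ c hΓ₀, fun {i j k b k₁} hij hjb hk hib x v ↦ ?_,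
    fun {i j k k₁} hij hj hk x v ↦ ?_⟩
  · rw [map_smul, LinearMap.smul_apply,
      corrAction_complexGysin_lift μ hT hP hP (X ◁ fst Y Y) (X ◁ snd Y Y) hde hk _ _, key hij x v,
      complexGysin_cup hμ hT hP (X ◁ fst Y Y) (show i + (j + 2 * e) = k + 2 * e by omega) _
        (show j + 2 * e + 2 * (n + m) = b + 2 * (n + (m + m)) by omega) hib,
      ← map_smul (cupProduct hib (complexBetti.map (fst X Y) i x)) c,
      ← hc (show j + 2 * e + 2 * m = b + 2 * (m + m) by omega), corrAction_apply]
  · rw [map_smul, LinearMap.smul_apply,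
      corrAction_complexGysin_lift μ hT hP hP (X ◁ fst Y Y) (X ◁ snd Y Y) hde hk _ _, key hij x v,
      complexGysin_cup_map_eq_zero_of_lt hT hP (X ◁ fst Y Y) (show i + (j + 2 * e) = k + 2 * e by omega) _
        (by omega), smul_zero]

/-- **The swap on cross products**: `σ^*(pr₁^* x ∪ pr₂^* v) = (−1)^{ij} · pr₁^* v ∪ pr₂^* x` for the switch
`σ = (pr₂, pr₁) : Y × X → X × Y` (graded commutativity of `∪`). [cite: HatcherAT2002, Thm. 3.11 (graded commutativity) and Thm. 3.15] -/
theorem map_swap_cupProduct_cross {i j k : ℕ} (hij : i + j = k) (hji : j + i = k) (x : complexBetti X i)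
    (v : complexBetti Y j) :
    complexBetti.map (lift (snd Y X) (fst Y X)) k
        (cupProduct hij (complexBetti.map (fst X Y) i x) (complexBetti.map (snd X Y) j v)) =
      ((-1 : ℂ) ^ (i * j)) •
        cupProduct hji (complexBetti.map (fst Y X) j v) (complexBetti.map (snd Y X) i x) := by
  have h1 := complexBetti.map_comp (lift (snd Y X) (fst Y X)) (fst X Y) i
  have h2 := complexBetti.map_comp (lift (snd Y X) (fst Y X)) (snd X Y) j
  rw [lift_fst] at h1
  rw [lift_snd] at h2
  rw [cupProduct_map, ← CategoryTheory.comp_apply (f := complexBetti.map (fst X Y) i)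
      (g := complexBetti.map (lift (snd Y X) (fst Y X)) i), ← h1,
    ← CategoryTheory.comp_apply (f := complexBetti.map (snd X Y) j)
      (g := complexBetti.map (lift (snd Y X) (fst Y X)) j), ← h2]
  exact cupProduct_gradedComm_holds ℂ _ hij hji _ _

end Whisker

end Summit.HodgeConjecture.HodgeConjecture.Ring2.AbelianAll

end
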